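import Summits.Ventures.HodgeRepro2.T5SU11ResolventIdentityDecay

/-!
# The Neumann expansion of the resolvent on the exponentially decaying class, with remainder

For `λ₂ > 1` and a source `g` of the exponentially decaying class at a rate `ε > 2 − λ₂` (continuous on `(0, ∞)`,
bounded on `(0, 1]`, `|g(s)| ≤ C e^{−εs}` for `s ≥ s₀`), the iterates `h_n = (G^I_{λ₂})^n g` of the improper Green's
operator of row 492 stay in the class at every rate `ε′ < min(ε, λ₂)` (`iterate_class`: row 499's stability applied
`n` times — each application loses an arbitrarily small amount of rate, and every rate below `min(ε, λ₂)` is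
reached). Hence row 500's identity applies to every iterate (`greenSolI_iterate_succ`:
`G^I_λ h_k = h_{k+1} + (μ − μ₂) G^I_λ h_{k+1}`), and iterating it gives, for `λ > 1`, `ε > 2 − λ` and every `n`,

**`G^I_λ g = Σ_{k=0}^{n} (μ − μ₂)^k (G^I_{λ₂})^{k+1} g + (μ − μ₂)^{n+1} G^I_λ (G^I_{λ₂})^{n+1} g`** on `(0, ∞)`

(`neumann_finite`) — the Neumann series of the resolvent `(L − μ)⁻¹` around `(L − μ₂)⁻¹` with its exact remainder,
which is itself in the class (`neumann_remainder_decay`: it decays at every rate `< min(ε, λ, λ₂)`). Nothing is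
claimed about (N).

Blind lane: Mathlib + the HodgeRepro2 prefix only; no sorry; axioms ⊆ {propext, Classical.choice,
Quot.sound}.
-/

namespace Summit.Ventures.HodgeRepro2.T5SU11ResolventNeumann

open Filter Topology MeasureTheory
open Set (Ioi Ioc)
open T5SU11Cartan T5SU11SphericalFunction T5SU11SphericalDecay T5SU11RadialGreenImproper
  T5SU11RadialGreenImproperStable T5SU11ResolventIdentityDecay

/-- A bound `|g(s)| ≤ C e^{−εs}` beyond `s₀` is a bound `|g(s)| ≤ |C| e^{−ε′s}` beyond `max(s₀, 0)` for every
`ε′ ≤ ε`. -/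
theorem abs_le_exp_of_le {g : ℝ → ℝ} {ε C s₀ ε' : ℝ} (hC : ∀ s, s₀ ≤ s → |g s| ≤ C * Real.exp (-ε * s))
    (hε' : ε' ≤ ε) : ∀ s, max s₀ 0 ≤ s → |g s| ≤ |C| * Real.exp (-ε' * s) := by
  intro s hs
  have hs0 : 0 ≤ s := le_trans (le_max_right _ _) hs
  calc |g s| ≤ C * Real.exp (-ε * s) := hC s (le_trans (le_max_left _ _) hs)
    _ ≤ |C| * Real.exp (-ε * s) := mul_le_mul_of_nonneg_right (le_abs_self C) (Real.exp_pos _).le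
    _ ≤ |C| * Real.exp (-ε' * s) := by
        apply mul_le_mul_of_nonneg_left _ (abs_nonneg C)
        apply Real.exp_le_exp.mpr
        nlinarith

section measure

variable [MeasurableSpace Circle] [BorelSpace Circle]

variable {lam lam₂ : ℝ} (hlam : 1 < lam) (hlam₂ : 1 < lam₂) {g : ℝ → ℝ} (hg : ContinuousOn g (Ioi 0))
  {M : ℝ} (hM : ∀ s ∈ Ioc (0 : ℝ) 1, |g s| ≤ M) (hM0 : 0 ≤ M)
  {ε C s₀ : ℝ} (hε : 2 - lam < ε) (hε₂ : 2 - lam₂ < ε) (hC : ∀ s, s₀ ≤ s → |g s| ≤ C * Real.exp (-ε * s))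

include hlam₂ hg hM hM0 hε₂ hC in
/-- **The iterates `(G^I_{λ₂})^n g` stay in the exponentially decaying class**: continuous on `(0, ∞)`, bounded on
`(0, 1]`, and decaying at every rate `ε′ < min(ε, λ₂)`. -/
theorem iterate_class (n : ℕ) :
    ContinuousOn ((greenSolI (fun t => sph lam₂ (hyp t)) (sphDecay lam₂))^[n] g) (Ioi 0) ∧
    (∃ M' : ℝ, 0 ≤ M' ∧ ∀ s ∈ Ioc (0 : ℝ) 1,
      |(greenSolI (fun t => sph lam₂ (hyp t)) (sphDecay lam₂))^[n] g s| ≤ M') ∧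
    (∀ ε' : ℝ, ε' < min ε lam₂ → ∃ K T : ℝ, 0 ≤ K ∧ 0 < T ∧ ∀ t, T ≤ t →
      |(greenSolI (fun t => sph lam₂ (hyp t)) (sphDecay lam₂))^[n] g t| ≤ K * Real.exp (-ε' * t)) := by
  induction n with
  | zero =>
    refine ⟨by simpa using hg, ⟨M, hM0, by simpa using hM⟩, fun ε' hε' => ?_⟩
    refine ⟨|C|, max (max s₀ 0) 1, abs_nonneg C, lt_of_lt_of_le one_pos (le_max_right _ _), fun t ht => ?_⟩
    simpa using abs_le_exp_of_le hC (le_of_lt (lt_of_lt_of_le hε' (min_le_left _ _))) t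
      (le_trans (le_max_left _ _) ht)
  | succ n ih =>
    obtain ⟨hcont, ⟨M', hM'0, hM'⟩, hdec⟩ := ih
    -- a rate `ε₁ ∈ (2 − λ₂, min(ε, λ₂))` for the `n`-th iterate
    have hmin : 2 - lam₂ < min ε lam₂ := lt_min hε₂ (by linarith)
    set ε₁ := (2 - lam₂ + min ε lam₂) / 2 with hε₁
    have hε₁1 : 2 - lam₂ < ε₁ := by rw [hε₁]; linarith
    have hε₁2 : ε₁ < min ε lam₂ := by rw [hε₁]; linarith
    obtain ⟨K₁, T₁, hK₁, hT₁, hKT₁⟩ := hdec ε₁ hε₁2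
    rw [Function.iterate_succ_apply']
    refine ⟨continuousOn_greenSolI hlam₂ hcont hM' hM'0 hε₁1 hKT₁,
      exists_abs_greenSolI_le_of_le_one hlam₂ hcont hM' hM'0 hε₁1 hKT₁, fun ε' hε' => ?_⟩
    -- a rate `ε₃ ∈ (max(ε′, 2 − λ₂), min(ε, λ₂))` for the `n`-th iterate, then row 499 at the rate `ε′ < ε₃`
    set ε₃ := (max ε' (2 - lam₂) + min ε lam₂) / 2 with hε₃
    have hmax : max ε' (2 - lam₂) < min ε lam₂ := max_lt hε' hmin
    have hε₃1 : 2 - lam₂ < ε₃ := by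
      rw [hε₃]; have := le_max_right ε' (2 - lam₂); linarith
    have hε₃2 : ε₃ < min ε lam₂ := by rw [hε₃]; linarith
    have hε₃3 : ε' < ε₃ := by
      rw [hε₃]; have := le_max_left ε' (2 - lam₂); linarith
    obtain ⟨K₃, T₃, hK₃, hT₃, hKT₃⟩ := hdec ε₃ hε₃2
    have hε'3 : ε' < min ε₃ lam₂ := lt_min hε₃3 (lt_of_lt_of_le hε' (min_le_right _ _))
    exact exists_abs_greenSolI_le_exp hlam₂ hcont hM' hM'0 hε₃1 hKT₃ hε'3

include hlam hlam₂ hg hM hM0 hε hε₂ hC in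
/-- **Row 500 for every iterate**: `G^I_λ h_k = h_{k+1} + (μ − μ₂) G^I_λ h_{k+1}` with `h_k = (G^I_{λ₂})^k g`. -/
theorem greenSolI_iterate_succ (k : ℕ) {t : ℝ} (ht : 0 < t) :
    greenSolI (fun t => sph lam (hyp t)) (sphDecay lam)
        ((greenSolI (fun t => sph lam₂ (hyp t)) (sphDecay lam₂))^[k] g) t
      = (greenSolI (fun t => sph lam₂ (hyp t)) (sphDecay lam₂))^[k + 1] g t
        + (lam * (lam - 2) - lam₂ * (lam₂ - 2))
          * greenSolI (fun t => sph lam (hyp t)) (sphDecay lam)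
            ((greenSolI (fun t => sph lam₂ (hyp t)) (sphDecay lam₂))^[k + 1] g) t := by
  obtain ⟨hcont, ⟨M', hM'0, hM'⟩, hdec⟩ := iterate_class hlam₂ hg hM hM0 hε₂ hC k
  -- a rate `ε₁ ∈ (max(2 − λ, 2 − λ₂), min(ε, λ₂))` for `h_k`
  have hmin : max (2 - lam) (2 - lam₂) < min ε lam₂ := max_lt (lt_min hε (by linarith)) (lt_min hε₂ (by linarith))
  set ε₁ := (max (2 - lam) (2 - lam₂) + min ε lam₂) / 2 with hε₁
  have hε₁1 : 2 - lam < ε₁ := by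
    rw [hε₁]; have := le_max_left (2 - lam) (2 - lam₂); linarith
  have hε₁2 : 2 - lam₂ < ε₁ := by
    rw [hε₁]; have := le_max_right (2 - lam) (2 - lam₂); linarith
  have hε₁3 : ε₁ < min ε lam₂ := by rw [hε₁]; linarith
  obtain ⟨K₁, T₁, hK₁, hT₁, hKT₁⟩ := hdec ε₁ hε₁3
  have h := greenSolI_sub_greenSolI_eq hlam hlam₂ hcont hM' hM'0 hε₁1 hε₁2 hKT₁ ht
  rw [Function.iterate_succ_apply']
  linear_combination h

include hlam hlam₂ hg hM hM0 hε hε₂ hC in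
/-- **THE NEUMANN EXPANSION OF THE RESOLVENT WITH REMAINDER**: for every `n`,
`G^I_λ g = Σ_{k=0}^{n} (μ − μ₂)^k (G^I_{λ₂})^{k+1} g + (μ − μ₂)^{n+1} G^I_λ (G^I_{λ₂})^{n+1} g` on `(0, ∞)`. -/
theorem neumann_finite (n : ℕ) {t : ℝ} (ht : 0 < t) :
    greenSolI (fun t => sph lam (hyp t)) (sphDecay lam) g t
      = (∑ k ∈ Finset.range (n + 1), (lam * (lam - 2) - lam₂ * (lam₂ - 2)) ^ k
          * (greenSolI (fun t => sph lam₂ (hyp t)) (sphDecay lam₂))^[k + 1] g t)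
        + (lam * (lam - 2) - lam₂ * (lam₂ - 2)) ^ (n + 1)
          * greenSolI (fun t => sph lam (hyp t)) (sphDecay lam)
            ((greenSolI (fun t => sph lam₂ (hyp t)) (sphDecay lam₂))^[n + 1] g) t := by
  induction n with
  | zero =>
    have h := greenSolI_iterate_succ hlam hlam₂ hg hM hM0 hε hε₂ hC 0 ht
    simp only [Function.iterate_zero, id_eq] at h
    simp only [Finset.sum_range_one, pow_zero, one_mul, zero_add, pow_one]
    exact h
  | succ n ih =>
    rw [ih, Finset.sum_range_succ _ (n + 1), greenSolI_iterate_succ hlam hlam₂ hg hM hM0 hε hε₂ hC (n + 1) ht]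
    ring

include hlam hlam₂ hg hM hM0 hε hε₂ hC in
/-- **The remainder is in the class**: `G^I_λ (G^I_{λ₂})^{n} g` decays at every rate `ε′ < min(ε, λ, λ₂)`. -/
theorem neumann_remainder_decay (n : ℕ) {ε' : ℝ} (hε' : ε' < min ε (min lam lam₂)) :
    ∃ K T : ℝ, 0 ≤ K ∧ 0 < T ∧ ∀ t, T ≤ t →
      |greenSolI (fun t => sph lam (hyp t)) (sphDecay lam)
        ((greenSolI (fun t => sph lam₂ (hyp t)) (sphDecay lam₂))^[n] g) t| ≤ K * Real.exp (-ε' * t) := by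
  obtain ⟨hcont, ⟨M', hM'0, hM'⟩, hdec⟩ := iterate_class hlam₂ hg hM hM0 hε₂ hC n
  have hε'1 : ε' < ε := lt_of_lt_of_le hε' (min_le_left _ _)
  have hε'2 : ε' < lam := lt_of_lt_of_le hε' (le_trans (min_le_right _ _) (min_le_left _ _))
  have hε'3 : ε' < lam₂ := lt_of_lt_of_le hε' (le_trans (min_le_right _ _) (min_le_right _ _))
  -- a rate `ε₃ ∈ (max(ε′, 2 − λ), min(ε, λ₂))` for `h_n`
  have hmax : max ε' (2 - lam) < min ε lam₂ := max_lt (lt_min hε'1 hε'3) (lt_min hε (by linarith))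
  set ε₃ := (max ε' (2 - lam) + min ε lam₂) / 2 with hε₃
  have hε₃1 : 2 - lam < ε₃ := by
    rw [hε₃]; have := le_max_right ε' (2 - lam); linarith
  have hε₃2 : ε₃ < min ε lam₂ := by rw [hε₃]; linarith
  have hε₃3 : ε' < ε₃ := by
    rw [hε₃]; have := le_max_left ε' (2 - lam); linarith
  obtain ⟨K₃, T₃, hK₃, hT₃, hKT₃⟩ := hdec ε₃ hε₃2
  exact exists_abs_greenSolI_le_exp hlam hcont hM' hM'0 hε₃1 hKT₃ (lt_min hε₃3 hε'2)

end measure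

end Summit.Ventures.HodgeRepro2.T5SU11ResolventNeumann
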